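import Summits.AnomalousDissipation.AnomalousDissipation.Theorems.SolenoidalFractalHomogenisationLagrangianStepDecayEnergy
import HarnessLib

/-!
# K1L_D (stmt-AnomalousDissipation-27980), stub `stub_oneLevelL_IW`: the decay-weighted energy is QUASI-INVARIANT under the frame map (S3′ brick)
# (helper; `--supports … --as helper`; assembles the two halves of `…LagrangianStepDecayEnergy`)

`Q_a(f ∘ X) ≤ 10M · Q_a(f)` for `0 < a ≤ 1/4`, where `Q_a(f) = Σ_ℓ min(1, a|ℓ|²)‖𝓕f(ℓ)‖²`, given the two transported facts the frame supplies:
the `L²` norm of the high part is not increased (`X` measure preserving) and the gradient energy of the low part grows at most by `M ≥ 1`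
(S1′(c): `M = e^{2C_dθ}`); the constant `10` is `2·M/M + 2·4`.  This is how S3′ passes the ledger's dissipation floor for a PHYSICAL test state `y` ((E_G) + flat modal decay) to the
FRAME coefficients of `y ∘ X` that (V_G)/(X_G) are stated in.  Infrastructure for rung F-D1.A0; NOT a proof of the crux or of anomalous dissipation.
-/

set_option linter.dupNamespace false

namespace Summit.AnomalousDissipation.AnomalousDissipation.Theorems.SolenoidalFractalHomogenisation.LagrangianStep

open MeasureTheory Literature.Analysis Literature.Analysis.FluidPDE Literature.Analysis.FunctionSpaces
open Literature.Analysis.FunctionSpaces.Torus UnitAddTorus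
open scoped ENNReal NNReal

/-- **Quasi-invariance of the decay-weighted energy under a frame map.**  Let `f ∈ L²`, `0 < a ≤ 1/4`, `N := ⌊a^{−1/2}⌋₊`, and let
`X : 𝕋³ → 𝕋³` be such that the compositions of the low part `P_N f` and of the high part `f − P_N f` with `X` are in `L²`, the high part's `L²`
mass is not increased, and the low part's gradient energy grows at most by the factor `M ≥ 1`.  Then
`Σ_ℓ min(1,a|ℓ|²)‖𝓕(f∘X)(ℓ)‖² ≤ 10M · Σ_ℓ min(1,a|ℓ|²)‖𝓕f(ℓ)‖²`. -/
theorem decayEnergy_comp_le {f : UnitAddTorus (Fin 3) → EuclideanSpace ℝ (Fin 3)} (hf : MemLp f 2 volume)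
    {a : ℝ} (ha : 0 < a) (ha4 : a ≤ 1 / 4) (X : UnitAddTorus (Fin 3) → UnitAddTorus (Fin 3)) {M : ℝ≥0∞} (hM : 1 ≤ M)
    (hX₁ : MemLp (fourierTruncate ⌊Real.sqrt a⁻¹⌋₊ f ∘ X) 2 volume)
    (hX₂ : MemLp ((fun x => f x - fourierTruncate ⌊Real.sqrt a⁻¹⌋₊ f x) ∘ X) 2 volume)
    (hgrad : eGradNormSq (fourierTruncate ⌊Real.sqrt a⁻¹⌋₊ f ∘ X) ≤ M * eGradNormSq (fourierTruncate ⌊Real.sqrt a⁻¹⌋₊ f))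
    (hL2 : ∫⁻ x, ‖((fun x => f x - fourierTruncate ⌊Real.sqrt a⁻¹⌋₊ f x) ∘ X) x‖ₑ ^ 2
        ≤ ∫⁻ x, ‖f x - fourierTruncate ⌊Real.sqrt a⁻¹⌋₊ f x‖ₑ ^ 2) :
    ∑' ℓ : Fin 3 → ℤ, ENNReal.ofReal (min 1 (a * freqNormSq ℓ)) * ‖mFourierCoeff (EuclideanSpace.complexify ∘ (f ∘ X)) ℓ‖ₑ ^ 2
      ≤ 10 * M * ∑' ℓ : Fin 3 → ℤ, ENNReal.ofReal (min 1 (a * freqNormSq ℓ)) * ‖mFourierCoeff (EuclideanSpace.complexify ∘ f) ℓ‖ₑ ^ 2 := by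
  set N : ℕ := ⌊Real.sqrt a⁻¹⌋₊ with hN
  -- the split of `f ∘ X`
  have hsplit : f ∘ X = (fourierTruncate N f ∘ X) + ((fun x => f x - fourierTruncate N f x) ∘ X) := by
    funext x; simp
  have hup := decayEnergy_le_of_split hX₁ hX₂ ha.le
  rw [← hsplit] at hup
  have hlow := decayEnergy_ge_split hf ha ha4
  -- the symmetric form of the tail: `‖P f − f‖ = ‖f − P f‖`
  have htail : ∫⁻ x, ‖fourierTruncate N f x - f x‖ₑ ^ 2 = ∫⁻ x, ‖f x - fourierTruncate N f x‖ₑ ^ 2 := by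
    refine lintegral_congr fun x => ?_
    rw [← enorm_neg, neg_sub]
  rw [htail] at hlow
  -- chain
  set G := eGradNormSq (fourierTruncate N f) with hG
  set T := ∫⁻ x, ‖f x - fourierTruncate N f x‖ₑ ^ 2 with hT
  set Q := ∑' ℓ : Fin 3 → ℤ, ENNReal.ofReal (min 1 (a * freqNormSq ℓ)) * ‖mFourierCoeff (EuclideanSpace.complexify ∘ f) ℓ‖ₑ ^ 2 with hQ
  have hA : ENNReal.ofReal (a / (4 * Real.pi ^ 2)) * G ≤ Q :=
    le_trans (le_add_of_nonneg_right bot_le) hlow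
  have hB : ENNReal.ofReal (1 / 4) * T ≤ Q :=
    le_trans (le_add_of_nonneg_left bot_le) hlow
  have hB' : T ≤ 4 * Q := by
    have h4 : (4 : ℝ≥0∞) * ENNReal.ofReal (1 / 4) = 1 := by
      rw [← ENNReal.ofReal_ofNat 4, ← ENNReal.ofReal_mul (by norm_num)]; norm_num
    calc T = 4 * (ENNReal.ofReal (1 / 4) * T) := by rw [← mul_assoc, h4, one_mul]
      _ ≤ 4 * Q := mul_le_mul_of_nonneg_left hB bot_le
  calc ∑' ℓ, ENNReal.ofReal (min 1 (a * freqNormSq ℓ)) * ‖mFourierCoeff (EuclideanSpace.complexify ∘ (f ∘ X)) ℓ‖ₑ ^ 2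
      ≤ 2 * (ENNReal.ofReal (a / (4 * Real.pi ^ 2)) * eGradNormSq (fourierTruncate N f ∘ X))
          + 2 * ∫⁻ x, ‖((fun x => f x - fourierTruncate N f x) ∘ X) x‖ₑ ^ 2 := hup
    _ ≤ 2 * (ENNReal.ofReal (a / (4 * Real.pi ^ 2)) * (M * G)) + 2 * T := by
        gcongr
    _ = 2 * M * (ENNReal.ofReal (a / (4 * Real.pi ^ 2)) * G) + 2 * T := by ring
    _ ≤ 2 * M * Q + 2 * (4 * Q) := by gcongr
    _ ≤ 2 * M * Q + 2 * (4 * (M * Q)) := by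
        gcongr
        calc Q = 1 * Q := (one_mul Q).symm
          _ ≤ M * Q := mul_le_mul_of_nonneg_right hM bot_le
    _ = 10 * M * Q := by ring

end Summit.AnomalousDissipation.AnomalousDissipation.Theorems.SolenoidalFractalHomogenisation.LagrangianStep
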